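import Mathlib
import Literature.Probability.MarkovChains.TotalVariation
import Summits.Ventures.LatticeQCDFlow.Exactness.FlowMCMC
import Summits.Ventures.LatticeQCDFlow.Exactness.JarzynskiFinite
import Summits.Ventures.LatticeQCDFlow.Scaling.ImportanceWeights
import Summits.Ventures.LatticeQCDFlow.Scaling.SectorBudget
import Summits.Ventures.LatticeQCDFlow.Scaling.StochasticFlows
import Summits.Ventures.LatticeQCDFlow.Scaling.StochasticBudgets

/-!
# LatticeQCDFlow / Scaling — barrier-catalogue SUPPLEMENTS for stochastic flows / NE-MCMC

HONEST FRAMING: exact (Metropolis-corrected) sampling algorithms for lattice gauge theory;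
figures of merit are autocorrelation/cost numbers at stated couplings and volumes; no
continuum-physics claim.

Venture `LatticeQCDFlow` (cell pub-lqcd).  Companion of `Scaling/Barriers.lean` (the four T4
entries B1–B4 of record + the v1.4 supplements): the three v1.5 supplements of
HOME/THEORY-2-Sketch.lean (theory seat) for out-of-equilibrium / stochastic-normalizing-flow
samplers, in the same barrier-docstring format, each a `def … : Prop` whose body is the PROVED
path-space core (`Scaling/{StochasticFlows, StochasticBudgets}.lean`, rebased on row 30's
`Exactness/JarzynskiFinite.lean`: `pathLaw`, `gibbsLaw`, `work`, `partitionFn`, `jarzynski`,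
`jarzynski_reweighting`) and each DISCHARGED by a theorem — landed by FANOUT row 31.

* `StochasticExactness` — Crooks pathwise from stationarity alone, Jarzynski (E4), the
  reweighting identity (E4′): `stochasticExactness`;
* `StochasticEndpointBudget` — a stochastic flow is no better than the law of its ENDPOINT
  (ESS / KL / dissipation / acceptance data processing): `stochasticEndpointBudget`;
* `PerfectRelaxationLaw` — with perfectly relaxing layers `ÊSS = ∏_k ESS(p_{k+1}, p_k)`
  `≤ exp(−Σ_k D(p_{k+1}‖p_k))`: `perfectRelaxationLaw`.
OUR results (LEAN PLACEMENT RULE: under the Venture, not `Literature/Barriers/`); the printed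
laws live in the docstrings.
-/

namespace Summit.Ventures.LatticeQCDFlow.Barriers

open Finset


/-- **Supplement (StochasticExactness) — why NE-MCMC / stochastic normalizing flows are exact, and
what exactly must hold.**  For a protocol of actions `S₀, …, S_n` on a finite configuration space
and ANY kernels `P_k` leaving `e^{−S_{k+1}}` STATIONARY (heat-bath, over-relaxation, their
compositions `1 HB + 4 OR`, flow-kernel sandwiches — detailed balance is NOT needed, and neither is
row-stochasticity): Crooks' identity holds PATHWISE, `P_F(ω)·e^{−W(ω)} = (Z_n/Z_0)·P_R(ω)` with
`P_R` the reverse path law built from the `e^{−S_{k+1}}`-reversals `P̂_k(y,x) = e^{−S_{k+1}(x)}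
P_k(x,y)/e^{−S_{k+1}(y)}`; hence Jarzynski `⟨e^{−W}⟩_F = Z_n/Z_0` (= the Venture's E4,
row 30's `Exactness.jarzynski`) and the
reweighting identity `⟨O(ω_n)·e^{−W}⟩_F = (Z_n/Z_0)·⟨O⟩_{p_n}`; used as a Metropolis proposal the
path is the INDEPENDENCE sampler on path space with target `P_R` and proposal `P_F`, acceptance
`min(1, e^{−(W′−W)})` [cite: BonannoEtAl2026, §2.1].
technique_class: out-of-equilibrium / annealed / stochastic-normalizing-flow samplers (Jarzynski
  reweighting or path-space Metropolis), any interleaving of deterministic coupling layers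
  (absorbed into the `S_k` by the change of variables with its log-Jacobian) and MC layers.
blocks: nothing by itself — it is the EXACTNESS half and fixes what the scorer must check for SNF
  lanes: (a) each MC layer stationary for ITS intermediate action (a kernel tuned for `S_{k+1}`
  applied while the bookkeeping uses another action breaks exactness); (b) the work
  `W = Σ_k (S_{k+1} − S_k)(ω_k)` is accumulated BEFORE the `k`-th update; (c) estimators are
  ratios `⟨O e^{−W}⟩/⟨e^{−W}⟩` (consistent, not unbiased) unless `Z_n/Z_0` is known.
because: PROVED `Theory2.crooks_pathwise` (field identity + telescoping of the Boltzmann factors),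
  `Theory2.sum_revPathLaw` (normalisation of `P_R` from stationarity alone, by summing out
  `ω₀, ω₁, …`), row 30's `Exactness.jarzynski`, `Exactness.jarzynski_reweighting` (E4/E4′ of record).
evasions_known: n/a (identity).
scope_caveats: finite state space, strictly positive Boltzmann weights; deterministic layers enter
  only through the actions (the change-of-variables formula is T2-G′'s business); continuous-time
  (Langevin) protocols are limits not covered here.
status: PROVED (`stochasticExactness`). -/
def StochasticExactness : Prop :=
  ∀ (X : Type) [Fintype X] [Nonempty X] (n : ℕ) (S : Fin (n+1) → X → ℝ) (P : Fin n → X → X → ℝ),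
    (∀ k : Fin n, Literature.Probability.MarkovChains.IsStationary
      (fun x => Real.exp (-(S k.succ x))) (P k)) →
    (∀ ω, Exactness.pathLaw (Exactness.gibbsLaw (S 0)) P ω * Real.exp (-(Exactness.work S ω)) =
        Exactness.partitionFn (S (Fin.last n)) / Exactness.partitionFn (S 0) * Theory2.revPathLaw S P ω) ∧
    ∑ ω, Exactness.pathLaw (Exactness.gibbsLaw (S 0)) P ω * Real.exp (-(Exactness.work S ω)) =
        Exactness.partitionFn (S (Fin.last n)) / Exactness.partitionFn (S 0) ∧
    ∀ f : X → ℝ, ∑ ω, Exactness.pathLaw (Exactness.gibbsLaw (S 0)) P ω * Real.exp (-(Exactness.work S ω)) *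
        f (ω (Fin.last n)) =
      Exactness.partitionFn (S (Fin.last n)) / Exactness.partitionFn (S 0) * ∑ x, Exactness.gibbsLaw (S (Fin.last n)) x * f x

/-- The supplement `StochasticExactness` is a theorem (discharged from the PROVED path-space cores). [folklore] -/
theorem stochasticExactness : StochasticExactness :=
  fun _ _ _ _ S P hst =>
    ⟨Theory2.crooks_pathwise S P, Exactness.jarzynski S P hst, Exactness.jarzynski_reweighting S P hst⟩

/-- **Supplement (StochasticEndpointBudget) to VolumeScalingOfTraining / TopologicalModeCollapse /
ExactnessVsExpressivity — a stochastic flow is no better than the law of its ENDPOINT.**  With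
`q_n :=` the actual law of the trajectory endpoint `ω_n` under the forward dynamics and
`p_n = e^{−S_n}/Z_n` the target: `ÊSS = ⟨e^{−W}⟩²/⟨e^{−2W}⟩ ≤ ESS(p_n, q_n)`,
`D(p_n‖q_n) ≤ D(P_R‖P_F)`, `D(q_n‖p_n) ≤ D(P_F‖P_R) = ⟨W⟩_F − ΔF` (mean dissipated work;
`ΔF = −log(Z_n/Z_0)`), and the path-Metropolis acceptance `≤ acc(p_n, q_n) ≤ 1 − ‖p_n − q_n‖_TV`;
also the sector mixing floor `p_n(B) − q₀-chain mass − ε ≤ t·q_n(B)`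
(`Theory2.path_sector_mixing_lower_bound`).  CONSEQUENCE: every v1.1–v1.4 budget stated for a
deterministic flow with model law `q` — `SectorWeightBudget` (sector weights of `q_n` vs `p_n` cap
the ESS), `ConcentrationBudget`, the block-defect volume laws, the sticking floor — applies VERBATIM
to NE-MCMC / SNF / CRAFT-type samplers with `q := q_n`; in particular topology: if the forward
dynamics started in equilibrium at `β₀` ends with endpoint sector weights `q_n(Q = k)`, the whole
sampler has `ÊSS ≤ (Σ_k p_n(Q=k)²/q_n(Q=k))⁻¹` whatever the work distribution looks like otherwise.
technique_class: out-of-equilibrium / stochastic normalizing flows with ANY stationary MC layers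
  and any protocol, judged by ÊSS, by `D̃_KL`, or by path-Metropolis acceptance.
blocks: claims that adding stochastic layers "solves" topological mode collapse at fixed endpoint
  sector weights; claims of volume- or β-uniform ÊSS whose endpoint law demonstrably under-covers
  a sector or a half-mass set (the deterministic-flow budgets then apply with `q_n`); reporting
  ÊSS without the endpoint sector histogram (FITNESS V8/V9 diagnostics apply to SNF lanes with
  `q_model_sector :=` the endpoint sector frequencies of the forward runs).
because: PROVED `Theory2.ess_path_le_ess_endpoint`, `Theory2.kl_endpoint_le_kl_path`,
  `Theory2.kl_path_eq_dissipation`, `Theory2.kl_endpoint_le_dissipation`,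
  `Theory2.acc_path_le_acc_endpoint`, `Theory2.path_sector_mixing_lower_bound` — all by
  coarse-graining path space along `ω ↦ ω_n` (`Theory2.coarse_last_revPathLaw`: the endpoint
  marginal of `P_R` is `p_n`; data processing `Theory2.essFrac_le_essFrac_coarse`,
  `Theory2.klFin_coarse_le`, `Exactness.accRate_le_accRate_coarse`).
evasions_known: make the endpoint law cover the sectors — longer protocols / more MC steps per
  layer near the freezing coupling, open-boundary or defect protocols that create charge
  [cite: BonannoEtAl2026, §5]; the budget then prices the residual endpoint defect only.
scope_caveats: one-sided (endpoint defect ⇒ loss); a perfect endpoint law does not make ÊSS large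
  (dissipation along the path remains: `PerfectRelaxationLaw`, C3′); finite state space.
status: PROVED (`stochasticEndpointBudget`). -/
def StochasticEndpointBudget : Prop :=
  ∀ (X : Type) [Fintype X] [DecidableEq X] [Nonempty X] (n : ℕ) (S : Fin (n+1) → X → ℝ)
    (P : Fin n → X → X → ℝ),
    (∀ k, Literature.Probability.MarkovChains.IsRowStochastic (P k)) → (∀ k x y, 0 < P k x y) →
    (∀ k : Fin n, Literature.Probability.MarkovChains.IsStationary
      (fun x => Real.exp (-(S k.succ x))) (P k)) →
    Theory2.essFrac (Theory2.revPathLaw S P) (Exactness.pathLaw (Exactness.gibbsLaw (S 0)) P) ≤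
        Theory2.essFrac (Exactness.gibbsLaw (S (Fin.last n)))
          (Theory2.coarse (fun ω : Fin (n+1) → X => ω (Fin.last n))
            (Exactness.pathLaw (Exactness.gibbsLaw (S 0)) P)) ∧
    Theory2.klFin (Exactness.gibbsLaw (S (Fin.last n)))
          (Theory2.coarse (fun ω : Fin (n+1) → X => ω (Fin.last n))
            (Exactness.pathLaw (Exactness.gibbsLaw (S 0)) P)) ≤
        Theory2.klFin (Theory2.revPathLaw S P) (Exactness.pathLaw (Exactness.gibbsLaw (S 0)) P) ∧
    Theory2.klFin (Theory2.coarse (fun ω : Fin (n+1) → X => ω (Fin.last n))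
            (Exactness.pathLaw (Exactness.gibbsLaw (S 0)) P)) (Exactness.gibbsLaw (S (Fin.last n))) ≤
        (∑ ω, Exactness.pathLaw (Exactness.gibbsLaw (S 0)) P ω * Exactness.work S ω) +
          Real.log (Exactness.partitionFn (S (Fin.last n)) / Exactness.partitionFn (S 0)) ∧
    Exactness.accRate (Theory2.revPathLaw S P) (Exactness.pathLaw (Exactness.gibbsLaw (S 0)) P) ≤
        Exactness.accRate (Exactness.gibbsLaw (S (Fin.last n)))
          (Theory2.coarse (fun ω : Fin (n+1) → X => ω (Fin.last n))
            (Exactness.pathLaw (Exactness.gibbsLaw (S 0)) P))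

/-- The supplement `StochasticEndpointBudget` is a theorem (discharged from the PROVED path-space cores). [folklore] -/
theorem stochasticEndpointBudget : StochasticEndpointBudget :=
  fun _ _ _ _ _ S P hP hPpos hst =>
    ⟨Theory2.ess_path_le_ess_endpoint S P hP hPpos hst,
      Theory2.kl_endpoint_le_kl_path S P hP hPpos hst,
      Theory2.kl_endpoint_le_dissipation S P hP hPpos hst, Theory2.acc_path_le_acc_endpoint S P hst⟩

/-- **Supplement (PerfectRelaxationLaw) to VolumeScalingOfTraining — the model in which the printed
`ÊSS(n_dof, n_step) = exp(−k′·n_dof/n_step)` law for stochastic flows is a THEOREM.**  If every MC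
layer relaxes perfectly (independent resampling from `e^{−S_{k+1}}/Z_{k+1}`), then EXACTLY
`ÊSS = Π_{k<n} ESS(p_{k+1}, p_k)` and hence `ÊSS ≤ exp(−Σ_k D(p_{k+1}‖p_k))`; for a local action
and a protocol linear in β each factor is a product over (quasi-)independent regions, so
`−log ÊSS` is EXTENSIVE in the volume at fixed protocol and `≈ (Δβ)²·Var(S_plaq-sum)/n_step ∝
n_dof/n_step` for `n_step` equal increments (thermodynamic-length / linear-response asymptotics)
[cite: BonannoEtAl2026, §3.1; BulgarelliCelliniNada2025].
technique_class: NE-MCMC / SNF cost models that extrapolate ÊSS in `n_dof/n_step`.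
blocks: reading the `n_dof/n_step` law as a LOWER bound valid for all kernels: it is the
  perfect-relaxation value; real kernels near the deconfinement / freezing coupling relax topology
  far slower (ÊSS then sits BELOW the law, cf. `StochasticEndpointBudget`), while correlated
  "echo" kernels can sit ABOVE it — THEORY-2.md §3.5 gives a stationary (non-reversible-looking but
  legal) reflection protocol with `W ≡ ΔF`, ÊSS `= 1`: conjecture C3 ("thermodynamic-length floor
  for the actual kernels") is FALSE for general stationary kernels and is re-filed as C3′
  (reversible, positive-semidefinite MC layers).
because: PROVED `Theory2.ess_perfect_relaxation` (path laws factorise: `Exactness.pathLaw_perfect`,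
  `Theory2.revPathLaw_perfect`, `Theory2.revKernel_perfect`; m-block ESS product law
  `Theory2.essFrac_blockProd`; `Theory2.essFrac_self`), `Theory2.ess_perfect_relaxation_le`
  (`Theory2.essFrac_le_exp_neg_kl` per step).
evasions_known: n/a (a law of the idealised model); protocols optimised for thermodynamic length
  (equal-KL steps) minimise `Σ_k D(p_{k+1}‖p_k)` at fixed `n` [folklore: Gelman–Meng path
  sampling, Salamon–Berry thermodynamic length].
scope_caveats: equality needs PERFECT relaxation; with partial relaxation neither inequality
  direction holds in general (above).
status: PROVED (`perfectRelaxationLaw`). -/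
def PerfectRelaxationLaw : Prop :=
  ∀ (X : Type) [Fintype X] [DecidableEq X] [Nonempty X] (n : ℕ) (S : Fin (n+1) → X → ℝ),
    Theory2.essFrac (Theory2.revPathLaw S (fun k _ y => Exactness.gibbsLaw (S k.succ) y))
        (Exactness.pathLaw (Exactness.gibbsLaw (S 0)) (fun k _ y => Exactness.gibbsLaw (S k.succ) y)) =
      ∏ k : Fin n, Theory2.essFrac (Exactness.gibbsLaw (S k.succ)) (Exactness.gibbsLaw (S k.castSucc)) ∧
    Theory2.essFrac (Theory2.revPathLaw S (fun k _ y => Exactness.gibbsLaw (S k.succ) y))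
        (Exactness.pathLaw (Exactness.gibbsLaw (S 0)) (fun k _ y => Exactness.gibbsLaw (S k.succ) y)) ≤
      Real.exp (-(∑ k : Fin n, Theory2.klFin (Exactness.gibbsLaw (S k.succ)) (Exactness.gibbsLaw (S k.castSucc))))

/-- The supplement `PerfectRelaxationLaw` is a theorem (discharged from the PROVED path-space cores). [folklore] -/
theorem perfectRelaxationLaw : PerfectRelaxationLaw :=
  fun _ _ _ _ _ S => ⟨Theory2.ess_perfect_relaxation S, Theory2.ess_perfect_relaxation_le S⟩

end Summit.Ventures.LatticeQCDFlow.Barriers
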